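import Summits.QuantumFields.BalabanUV.Beta.WilsonBiStencilWardSocket
import Summits.QuantumFields.BalabanUV.Beta.WardLocusQuartic
import Summits.QuantumFields.BalabanUV.Beta.KernelWardLevels

/-!
# `BalabanUV.Beta.WilsonWardSocketFit` — row D1, (L4) W-side, ONE `T` FOR hR AND hW: the hW Wilson binders `hWil` / `hWil''` of
# `WardLocusRecursiveAll.divW_WrecAt_zero_of_letters` AT THE hR TABLE `T_W := (8N²)⁻¹ • wsym22 N`, remainders ZERO, under the hW pin `cE₂ = Lc^{2(d+1)}`
# (β sub-cell, unit `b2b-balaban-beta-an3`, GEN 32, step S3f; referee item I-d1ref12-1 «ONE-T»)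

HONEST FRAMING (cell charter, verbatim): «discharging `BetaPertH` makes Bałaban's UV stability UNCONDITIONAL — a real constructive-QFT result;
it is NOT the continuum limit and NOT the Clay problem.»  HONEST DEPENDENCY (cell records, verbatim): «continuum YM on T⁴ ⇐ BetaPertH ∧ nine spine
estimates (0/9 proved); BetaPertH ⇐ (D1) ∧ (D4) ∧ CAP+tail; G-an2-4 gates asym, D1 and NE2/3/4.»  DERIVED cell leaf: finite algebra over `ℤ^{d+1}`,
nothing cited — every statement is kernel-proved here ([folklore]); no `[cite:]` tag, no `def`.  By itself this file instantiates NO binder of the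
β-function wall.  NOT D1, NOT `BetaPertH`, NOT continuum, NOT Clay.

ABSOLUTE RULE (cell charter, verbatim): «No internally-minted statement may enter as a cited fact. Every hypothesis is either kernel-proved in this
package or a verbatim quotation of a PUBLISHED theorem with page reference. The manuscript(s) under audit are NOT citable for their own disputed
steps — they are the thing under adjudication; programme-internal (2001/route/tribunal) claims are never citable.»

## What

On the hR side the Wilson letter is kernel-fixed at the table `T_W := (8N²)⁻¹ • wsym22 N` (`WilsonReflectionContact2.wilsonW₂_bref_ff_canon_bhKAt`,
the hR END `SpineRecursiveT2AllCanon.…_of_letters_canon` applied with `T := T_W`, `RW := 0`).  On the hW side leaf-09's socket rows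
`WilsonBiStencilWardSocket.hS₂_wilson` / `hS₂''_wilson` are stated at `wsym22 N` with a free Ward constant `cH` under the lock `cH·4N² = c·ξ`.  The
final assembly takes ONE kernel family, hence ONE `T`.  This file transports the hW rows to `T_W`:

* §1 `divV_wilsonW₂_smul_fst` / `_snd` — the scalar transfer `divV (κ u ↦ cE₂ • wilsonW₂ d (s • T) κ u κ′ u′) = (cE₂·s) • divV (κ u ↦ wilsonW₂ d T κ u κ′ u′)`
  (both background slots; `WilsonBiStencil.wilsonW₂_smul` + `WardLocusQuartic.divV_smul` BY NAME).
* §2 **`hWil_wilson_TW`** / **`hWil''_wilson_TW`** — LITERALLY the binders `hWil` / `hWil''` of `WardLocusRecursiveAll.divW_WrecAt_zero_of_letters`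
  (Ward constant `(stepScale d Lc 0 · Lc^{d+1})⁻¹`, first-order letter `Lc^{d+1} • wilsonA d`, generator weight `½`, root `toSite r`, blocking `Lc`) at
  `T := (8 * (N:ℝ)^2)⁻¹ • wsym22 N` with `RW := 0`, `RW'' := 0`, under the hW pin `hcE₂ : cE₂ = (Lc:ℝ)^(2*(d+1))` (the literal pin of
  `WardLocusRecursiveAll.divW_WrecAt_succ_of_kernelLaw`): the lock `cH·4N² = Lc^{d+1}·½` with `cH = (stepScale 0 · Lc^{d+1})⁻¹ · cE₂ · (8N²)⁻¹` holds
  EXACTLY when `cE₂ = Lc^{2(d+1)}` (`stepScale 0 = 1`) — the same pin the hR side reads as `lock2` (`cE₂ = Lc⁸` at `d = 3`).  So ONE `T = T_W` and ONE pin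
  serve both the hR and the hW Wilson letters with ZERO remainders; `d = 3` forms with the pin written `cE₂ = Lc⁸`: `hWil_wilson_TW₃` / `hWil''_wilson_TW₃`.

NOT HERE: the border / mixed letters (an1), the bounds sockets of the zero remainders (`|0| ≤ 0`, one `simp` at the call site), the assembly (owner),
any statement of Bałaban's papers.

Provenance: pub-balaban β sub-cell, unit `b2b-balaban-beta-an3` GEN 32, 2026-08-20 (v1); over leaf-09-g4's `WilsonBiStencilWardSocket` (p216163),
`WardLocusQuartic.divV_smul`, `KernelWardLevels.stepScale_zero` and Literature `WilsonBiStencil.wilsonW₂_smul` BY NAME; no existing file touched.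
-/

namespace Summit.QuantumFields.BalabanUV.Beta.WilsonWardSocketFit

open Finset
open scoped BigOperators
open Literature.MathematicalPhysics.QuantumFieldTheory.Balaban1983to89
open Literature.MathematicalPhysics.QuantumFieldTheory.Balaban1983to89.Beta
open ColourTrace (Complete TrOrthonormal)
open WilsonVertex2Sym (wsym22)
open WilsonBiStencil (wilsonW₂ wilsonW₂_smul)
open StepJetData (wilsonA)
open ExpKernelCalculus (MKer comp)
open OneStepResolventKernel (Fib)
open KernelWard (divV)
open AffineAveraging (box toSite)
open Summit.QuantumFields.BalabanUV.Beta.BorderedHessian (diagK stepScale)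
open Summit.QuantumFields.BalabanUV.Beta.AveragingWardRootedStencils (legInd)
open Summit.QuantumFields.BalabanUV.Beta.KernelWardLevels (stepScale_zero)
open Summit.QuantumFields.BalabanUV.Beta.WardLocusQuartic (divV_smul)
open Summit.QuantumFields.BalabanUV.Beta.WilsonBiStencilWardSocket (hS₂_wilson hS₂''_wilson)

variable {d : ℕ} {N : ℕ}

/-! ## §1 Scalar transfer of the background divergence along the table -/

/-- [folklore] **SCALAR TRANSFER, FIRST BACKGROUND SLOT**: `divV (κ u ↦ cE₂ • wilsonW₂ d (s • T) κ u κ′ u′) y = (cE₂·s) • divV (κ u ↦ wilsonW₂ d T κ u κ′ u′) y`. -/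
theorem divV_wilsonW₂_smul_fst (cE₂ s : ℝ) (T : Fin 4 → Fin 4 → Fin 4 → Fin 4 → ℝ) (κ' : Fin (d + 1)) (u' : Fin (d + 1) → ℤ) (y : Fin (d + 1) → ℤ) :
    divV (fun κ u => cE₂ • wilsonW₂ d (s • T) κ u κ' u') y = (cE₂ * s) • divV (fun κ u => wilsonW₂ d T κ u κ' u') y := by
  have h : (fun κ u => cE₂ • wilsonW₂ d (s • T) κ u κ' u') = fun κ u => (cE₂ * s) • wilsonW₂ d T κ u κ' u' := by
    funext κ u
    rw [wilsonW₂_smul, smul_smul]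
  rw [h, divV_smul]

/-- [folklore] **SCALAR TRANSFER, SECOND BACKGROUND SLOT**: `divV (κ′ u′ ↦ cE₂ • wilsonW₂ d (s • T) κ u κ′ u′) y = (cE₂·s) • divV (wilsonW₂ d T κ u) y`. -/
theorem divV_wilsonW₂_smul_snd (cE₂ s : ℝ) (T : Fin 4 → Fin 4 → Fin 4 → Fin 4 → ℝ) (κ : Fin (d + 1)) (u : Fin (d + 1) → ℤ) (y : Fin (d + 1) → ℤ) :
    divV (fun κ' u' => cE₂ • wilsonW₂ d (s • T) κ u κ' u') y = (cE₂ * s) • divV (wilsonW₂ d T κ u) y := by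
  have h : (fun κ' u' => cE₂ • wilsonW₂ d (s • T) κ u κ' u') = fun κ' u' => (cE₂ * s) • wilsonW₂ d T κ u κ' u' := by
    funext κ' u'
    rw [wilsonW₂_smul, smul_smul]
  rw [h, divV_smul]

/-! ## §2 The hW Wilson binders at `T_W = (8N²)⁻¹ • wsym22 N`, remainders zero, under the pin `cE₂ = Lc^{2(d+1)}` -/

section Socket

variable {C : Type*} [Fintype C] [DecidableEq C] {τ : C → Matrix (Fin N) (Fin N) ℂ}

/-- [folklore] The units lock of the hW Wilson rows at `T_W`: with `cH = (stepScale 0 · Lc^{d+1})⁻¹ · (cE₂ · (8N²)⁻¹)` and the pin `cE₂ = Lc^{2(d+1)}`,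
`cH · 4N² = Lc^{d+1} · ½`. -/
theorem lock_TW (hN : N ≠ 0) (Lc : ℕ) [NeZero Lc] {cE₂ : ℝ} (hcE₂ : cE₂ = (Lc : ℝ) ^ (2 * (d + 1))) :
    (stepScale d Lc 0 * (Lc : ℝ) ^ (d + 1))⁻¹ * (cE₂ * (8 * (N : ℝ) ^ 2)⁻¹) * (4 * (N : ℝ) ^ 2) = (Lc : ℝ) ^ (d + 1) * ((1 : ℝ) / 2) := by
  have hL : (Lc : ℝ) ≠ 0 := Nat.cast_ne_zero.mpr (NeZero.ne Lc)
  have hN' : (N : ℝ) ≠ 0 := Nat.cast_ne_zero.mpr hN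
  rw [stepScale_zero, hcE₂, show 2 * (d + 1) = (d + 1) + (d + 1) by ring, pow_add]
  field_simp
  ring

/-- [folklore] **THE hW WILSON BINDER `hWil` AT `T_W`, REMAINDER ZERO** — literally the hypothesis `hWil` of
`WardLocusRecursiveAll.divW_WrecAt_zero_of_letters` at `T := (8 * (N:ℝ)^2)⁻¹ • wsym22 N`, `RW := 0`, under the hW pin `cE₂ = Lc^{2(d+1)}`. -/
theorem hWil_wilson_TW (hτ : Complete τ) (ho : TrOrthonormal τ) (hN : N ≠ 0) (c : C) (Lc : ℕ) [NeZero Lc] (r : Fin (d + 1) → ℕ) {cE₂ : ℝ}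
    (hcE₂ : cE₂ = (Lc : ℝ) ^ (2 * (d + 1))) :
    ∀ (Y : Fin (d + 1) → ℤ) (κ' : Fin (d + 1)) (u' : Fin (d + 1) → ℤ),
      (stepScale d Lc 0 * (Lc : ℝ) ^ (d + 1))⁻¹ • ∑ v ∈ box (d + 1) Lc,
          divV (fun κ u => cE₂ • wilsonW₂ d ((8 * (N : ℝ) ^ 2)⁻¹ • wsym22 N) κ u κ' u') ((Lc : ℤ) • Y + toSite v) =
        comp (((Lc : ℝ) ^ (d + 1)) • wilsonA d κ' u') (diagK (((1 : ℝ) / 2) • ∑ v ∈ box (d + 1) Lc, legInd (toSite r) ((Lc : ℤ) • Y + toSite v)))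
          - comp (diagK (((1 : ℝ) / 2) • ∑ v ∈ box (d + 1) Lc, legInd (toSite r) ((Lc : ℤ) • Y + toSite v))) (((Lc : ℝ) ^ (d + 1)) • wilsonA d κ' u')
          + (0 : (Fin (d + 1) → ℤ) → Fin (d + 1) → (Fin (d + 1) → ℤ) → MKer (d + 1) (Fib d)) Y κ' u' := by
  intro Y κ' u'
  simp only [divV_wilsonW₂_smul_fst, ← Finset.smul_sum, smul_smul, Pi.zero_apply]
  exact hS₂_wilson hτ ho hN c Lc (toSite r) (lock_TW hN Lc hcE₂) Y κ' u'

/-- [folklore] **THE hW WILSON BINDER `hWil''` AT `T_W`, REMAINDER ZERO** — literally the hypothesis `hWil''` of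
`WardLocusRecursiveAll.divW_WrecAt_zero_of_letters` at `T := (8 * (N:ℝ)^2)⁻¹ • wsym22 N`, `RW'' := 0`, under the hW pin `cE₂ = Lc^{2(d+1)}`. -/
theorem hWil''_wilson_TW (hτ : Complete τ) (ho : TrOrthonormal τ) (hN : N ≠ 0) (c : C) (Lc : ℕ) [NeZero Lc] (r : Fin (d + 1) → ℕ) {cE₂ : ℝ}
    (hcE₂ : cE₂ = (Lc : ℝ) ^ (2 * (d + 1))) :
    ∀ (Y : Fin (d + 1) → ℤ) (κ : Fin (d + 1)) (u : Fin (d + 1) → ℤ),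
      (stepScale d Lc 0 * (Lc : ℝ) ^ (d + 1))⁻¹ • ∑ v ∈ box (d + 1) Lc,
          divV (fun κ' u' => cE₂ • wilsonW₂ d ((8 * (N : ℝ) ^ 2)⁻¹ • wsym22 N) κ u κ' u') ((Lc : ℤ) • Y + toSite v) =
        comp (((Lc : ℝ) ^ (d + 1)) • wilsonA d κ u) (diagK (((1 : ℝ) / 2) • ∑ v ∈ box (d + 1) Lc, legInd (toSite r) ((Lc : ℤ) • Y + toSite v)))
          - comp (diagK (((1 : ℝ) / 2) • ∑ v ∈ box (d + 1) Lc, legInd (toSite r) ((Lc : ℤ) • Y + toSite v))) (((Lc : ℝ) ^ (d + 1)) • wilsonA d κ u)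
          + (0 : (Fin (d + 1) → ℤ) → Fin (d + 1) → (Fin (d + 1) → ℤ) → MKer (d + 1) (Fib d)) Y κ u := by
  intro Y κ u
  simp only [divV_wilsonW₂_smul_snd, ← Finset.smul_sum, smul_smul, Pi.zero_apply]
  exact hS₂''_wilson hτ ho hN c Lc (toSite r) (lock_TW hN Lc hcE₂) Y κ u

/-- [folklore] `d = 3` form of `hWil_wilson_TW` with the pin written as on the hR side, `cE₂ = Lc⁸`. -/
theorem hWil_wilson_TW₃ (hτ : Complete τ) (ho : TrOrthonormal τ) (hN : N ≠ 0) (c : C) (Lc : ℕ) [NeZero Lc] (r : Fin 4 → ℕ) {cE₂ : ℝ}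
    (hcE₂ : cE₂ = (Lc : ℝ) ^ 8) :
    ∀ (Y : Fin 4 → ℤ) (κ' : Fin 4) (u' : Fin 4 → ℤ),
      (stepScale 3 Lc 0 * (Lc : ℝ) ^ (3 + 1))⁻¹ • ∑ v ∈ box (3 + 1) Lc,
          divV (fun κ u => cE₂ • wilsonW₂ 3 ((8 * (N : ℝ) ^ 2)⁻¹ • wsym22 N) κ u κ' u') ((Lc : ℤ) • Y + toSite v) =
        comp (((Lc : ℝ) ^ (3 + 1)) • wilsonA 3 κ' u') (diagK (((1 : ℝ) / 2) • ∑ v ∈ box (3 + 1) Lc, legInd (toSite r) ((Lc : ℤ) • Y + toSite v)))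
          - comp (diagK (((1 : ℝ) / 2) • ∑ v ∈ box (3 + 1) Lc, legInd (toSite r) ((Lc : ℤ) • Y + toSite v))) (((Lc : ℝ) ^ (3 + 1)) • wilsonA 3 κ' u')
          + (0 : (Fin 4 → ℤ) → Fin 4 → (Fin 4 → ℤ) → MKer (3 + 1) (Fib 3)) Y κ' u' :=
  hWil_wilson_TW (d := 3) hτ ho hN c Lc r (by rw [hcE₂])

/-- [folklore] `d = 3` form of `hWil''_wilson_TW` with the pin written as on the hR side, `cE₂ = Lc⁸`. -/
theorem hWil''_wilson_TW₃ (hτ : Complete τ) (ho : TrOrthonormal τ) (hN : N ≠ 0) (c : C) (Lc : ℕ) [NeZero Lc] (r : Fin 4 → ℕ) {cE₂ : ℝ}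
    (hcE₂ : cE₂ = (Lc : ℝ) ^ 8) :
    ∀ (Y : Fin 4 → ℤ) (κ : Fin 4) (u : Fin 4 → ℤ),
      (stepScale 3 Lc 0 * (Lc : ℝ) ^ (3 + 1))⁻¹ • ∑ v ∈ box (3 + 1) Lc,
          divV (fun κ' u' => cE₂ • wilsonW₂ 3 ((8 * (N : ℝ) ^ 2)⁻¹ • wsym22 N) κ u κ' u') ((Lc : ℤ) • Y + toSite v) =
        comp (((Lc : ℝ) ^ (3 + 1)) • wilsonA 3 κ u) (diagK (((1 : ℝ) / 2) • ∑ v ∈ box (3 + 1) Lc, legInd (toSite r) ((Lc : ℤ) • Y + toSite v)))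
          - comp (diagK (((1 : ℝ) / 2) • ∑ v ∈ box (3 + 1) Lc, legInd (toSite r) ((Lc : ℤ) • Y + toSite v))) (((Lc : ℝ) ^ (3 + 1)) • wilsonA 3 κ u)
          + (0 : (Fin 4 → ℤ) → Fin 4 → (Fin 4 → ℤ) → MKer (3 + 1) (Fib 3)) Y κ u :=
  hWil''_wilson_TW (d := 3) hτ ho hN c Lc r (by rw [hcE₂])

end Socket

end Summit.QuantumFields.BalabanUV.Beta.WilsonWardSocketFit
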